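import Summits.QuantumAdvantage.QuantumAdvantage.Theorems.WbwObfuscatedGluedTreesKowRiVocabulary

/-!
# `WbwObfuscatedGluedTrees` (stmt-QuantumAdvantage-2340) — line `knowledge-of-walk-split`, STAGE 6:
# the averaging stub `stub_average`

Support file of the stage-6 skeleton (target
`…Cruxes.WbwObfuscatedGluedTrees.KnowledgeOfWalkSplit.RealIdeal.IdealCodeSoundness`) of the INFORMAL crux
`WbwObfuscatedGluedTrees` (route `Theses/WhiteBoxWalk`; lead prover-line-stmt-QuantumAdvantage-2340-c5-0): the
registered stub `stub_average`.  Pure finite averaging, no graph theory and no cryptography: if the ideal-II naming of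
a table quadruple `H = (Hn, Hc)` is the SIV naming of the tag / mask tables of the naming pair `Hn` (hypothesis (a)),
the tables map `Hn ↦ (tagT Hn.1 d, maskT Hn.2 d)` counts every event proportionally (hypothesis (b)), and for every
naming pair the code cycle loses at most `ε` against the uniform cycle datum (hypothesis (c)), then
`codeSuccessProb ≤ sivSuccessProb + ε`.  The proof is Fubini over the two pairs of tables (`average_core`, stated over
abstract finite types), the termwise bound, and the fibrewise re-indexing of the naming pair by its tables; the real
arithmetic is `average_arith`. [folklore]
-/

set_option linter.dupNamespace false

noncomputable section

namespace Summit.QuantumAdvantage.QuantumAdvantage.Theorems.WbwObfuscatedGluedTrees.KnowledgeOfWalk.RealIdeal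

open Literature.Computability.Complexity Literature.Computability.QuantumComplexity
open Literature.Computability.QuantumComplexity.GluedTrees
open Literature.Computability.Cryptography Literature.Computability.Cryptography.ObfuscatedGluedTrees
open Summit.QuantumAdvantage.QuantumAdvantage.Theorems.WbwObfuscatedGluedTrees.KnowledgeOfWalk.BlackBox

/-- The real arithmetic of the averaging step: from `F / B ≤ G / C + A ε` (the summed termwise bound) and the
re-indexing identity `G · T = Y · A` to `F / (A B) ≤ Y / (C T) + ε`. [folklore] -/
theorem average_arith {F G Y A B C T ε : ℝ} (hA : 0 < A) (hB : 0 < B) (hC : 0 < C) (hT : 0 < T)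
    (h2 : F / B ≤ G / C + A * ε) (h3 : G * T = Y * A) : F / (A * B) ≤ Y / (C * T) + ε := by
  have hG : G / C = A * Y / (C * T) := by
    rw [div_eq_div_iff hC.ne' (mul_pos hC hT).ne']
    linear_combination C * h3
  rw [div_le_iff₀ (mul_pos hA hB)]
  calc F ≤ (G / C + A * ε) * B := (div_le_iff₀ hB).mp h2
    _ = (Y / (C * T) + ε) * (A * B) := by rw [hG]; ring

open Classical in
/-- **Abstract averaging** over finite types (`α` the naming pairs, `β` the cycle pairs, `γ` the cycle data, `τ` the
table pairs): if the naming `nm` of a pair factors through the tables `tab` of its first component (`ha`), the tables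
map counts every event proportionally (`hb`, cross-multiplied), and for every naming pair the `cy`-success fraction is
at most the uniform-`γ` success fraction plus `ε` (`hc`), then the success fraction over `α × β` is at most the
success fraction over `γ × τ` plus `ε` (Fubini, termwise bound, fibrewise re-indexing). [folklore] -/
theorem average_core {α β γ τ N : Type*} [Fintype α] [Fintype β] [Fintype γ] [Fintype τ]
    [Nonempty α] [Nonempty β] [Nonempty γ] [Nonempty τ]
    (S : γ → N → Prop) (cy : α × β → γ) (nm : α × β → N) (ν : τ → N) (tab : α → τ) (ε : ℝ)
    (ha : ∀ p, nm p = ν (tab p.1))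
    (hb : ∀ (E : τ → Prop) [DecidablePred E],
      (Finset.univ.filter fun a => E (tab a)).card * Fintype.card τ =
        (Finset.univ.filter E).card * Fintype.card α)
    (hc : ∀ a, ((Finset.univ.filter fun b => S (cy (a, b)) (ν (tab a))).card : ℝ) / Fintype.card β ≤
      ((Finset.univ.filter fun σ => S σ (ν (tab a))).card : ℝ) / Fintype.card γ + ε) :
    ((Finset.univ.filter fun p : α × β => S (cy p) (nm p)).card : ℝ) / Fintype.card (α × β) ≤
      ((Finset.univ.filter fun r : γ × τ => S r.1 (ν r.2)).card : ℝ) / Fintype.card (γ × τ) + ε := by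
  classical
  -- positivity of the cardinalities
  have hα : (0 : ℝ) < Fintype.card α := Nat.cast_pos.mpr Fintype.card_pos
  have hβ : (0 : ℝ) < Fintype.card β := Nat.cast_pos.mpr Fintype.card_pos
  have hγ : (0 : ℝ) < Fintype.card γ := Nat.cast_pos.mpr Fintype.card_pos
  have hτ : (0 : ℝ) < Fintype.card τ := Nat.cast_pos.mpr Fintype.card_pos
  -- (1) Fubini over the two pairs, the naming rewritten by `ha`
  have h1 : (Finset.univ.filter fun p : α × β => S (cy p) (nm p)).card =
      ∑ a, (Finset.univ.filter fun b => S (cy (a, b)) (ν (tab a))).card := by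
    simp only [Finset.card_filter]
    rw [Fintype.sum_prod_type]
    refine Finset.sum_congr rfl fun a _ => Finset.sum_congr rfl fun b _ => ?_
    rw [ha]
  -- (2) the termwise bound `hc`, summed over the naming pairs
  have h2 : (∑ a, ((Finset.univ.filter fun b => S (cy (a, b)) (ν (tab a))).card : ℝ)) / Fintype.card β ≤
      (∑ a, ((Finset.univ.filter fun σ => S σ (ν (tab a))).card : ℝ)) / Fintype.card γ +
        Fintype.card α * ε := by
    rw [Finset.sum_div, Finset.sum_div]
    calc ∑ a, ((Finset.univ.filter fun b => S (cy (a, b)) (ν (tab a))).card : ℝ) / Fintype.card β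
        ≤ ∑ a, (((Finset.univ.filter fun σ => S σ (ν (tab a))).card : ℝ) / Fintype.card γ + ε) :=
          Finset.sum_le_sum fun a _ => hc a
      _ = (∑ a, ((Finset.univ.filter fun σ => S σ (ν (tab a))).card : ℝ) / Fintype.card γ) +
            Fintype.card α * ε := by
          rw [Finset.sum_add_distrib, Finset.sum_const, Finset.card_univ, nsmul_eq_mul]
  -- (3) re-indexing the naming pair by its tables, fibrewise (`hb`), after swapping the double count
  have h3 : (∑ a, (Finset.univ.filter fun σ => S σ (ν (tab a))).card) * Fintype.card τ =
      (Finset.univ.filter fun r : γ × τ => S r.1 (ν r.2)).card * Fintype.card α := by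
    have hsw : ∑ a, (Finset.univ.filter fun σ => S σ (ν (tab a))).card =
        ∑ σ, (Finset.univ.filter fun a => S σ (ν (tab a))).card := by
      simp only [Finset.card_filter]
      exact Finset.sum_comm
    have hY : (Finset.univ.filter fun r : γ × τ => S r.1 (ν r.2)).card =
        ∑ σ, (Finset.univ.filter fun q => S σ (ν q)).card := by
      simp only [Finset.card_filter]
      exact Fintype.sum_prod_type' fun σ q => if S σ (ν q) then 1 else 0
    rw [hsw, hY, Finset.sum_mul, Finset.sum_mul]
    exact Finset.sum_congr rfl fun σ _ => hb fun q => S σ (ν q)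
  have h3r : (∑ a, ((Finset.univ.filter fun σ => S σ (ν (tab a))).card : ℝ)) * Fintype.card τ =
      ((Finset.univ.filter fun r : γ × τ => S r.1 (ν r.2)).card : ℝ) * Fintype.card α := by
    exact_mod_cast h3
  -- (4) the arithmetic
  rw [h1, Fintype.card_prod, Fintype.card_prod, Nat.cast_sum, Nat.cast_mul, Nat.cast_mul]
  exact average_arith hα hβ hγ hτ h2 h3r

open Classical in
/-- **Stub `stub_average`** (averaging over the naming pair) of crux stmt-QuantumAdvantage-2340, line
`knowledge-of-walk-split`, stage 6: if the code naming is the SIV naming of the tables of the naming pair, those tables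
are equidistributed (events counted proportionally), and for EVERY naming pair the code cycle loses at most `ε` against
the uniform cycle, then `codeSuccessProb ≤ sivSuccessProb + ε` (Fubini over the two pairs of tables; re-indexing the
naming pair by its tables fibrewise; instance of `average_core`). [folklore] -/
theorem stub_average : ∀ (d μ : ℕ) (M : OracleAlg (List Bool)) (x : List Bool) (t : ℕ) (ε : ℝ),
    (∀ (μ d : ℕ) (H : CodeSpace μ), codeNaming H d = sivNaming (tagT H.1.1 d) (maskT H.1.2 d)) →
    (∀ (E : TagTable d μ × MaskTable d μ → Prop) [DecidablePred E],
      (Finset.univ.filter fun Hn : PrfTable μ × PrfTable μ => E (tagT Hn.1 d, maskT Hn.2 d)).card *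
          Fintype.card (TagTable d μ × MaskTable d μ) =
        (Finset.univ.filter E).card * Fintype.card (PrfTable μ × PrfTable μ)) →
    (∀ Hn : PrfTable μ × PrfTable μ,
      ((Finset.univ.filter fun Hc : PrfTable μ × PrfTable μ =>
            BitSuccess M x t (codeCycle (Hn, Hc) d) (sivNaming (tagT Hn.1 d) (maskT Hn.2 d))).card : ℝ) /
          Fintype.card (PrfTable μ × PrfTable μ) ≤
        ((Finset.univ.filter fun σ : CycleDatum d =>
            BitSuccess M x t σ (sivNaming (tagT Hn.1 d) (maskT Hn.2 d))).card : ℝ) / Fintype.card (CycleDatum d) + ε) →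
    codeSuccessProb d μ M x t ≤ sivSuccessProb d μ M x t + ε := by
  classical
  intro d μ M x t ε ha hb hc
  unfold codeSuccessProb sivSuccessProb
  exact average_core (fun (σ : CycleDatum d) (nv : NamingN d (nameLen μ d)) => BitSuccess M x t σ nv)
    (fun H : CodeSpace μ => codeCycle H d) (fun H : CodeSpace μ => codeNaming H d)
    (fun q : TagTable d μ × MaskTable d μ => sivNaming q.1 q.2)
    (fun Hn : PrfTable μ × PrfTable μ => (tagT Hn.1 d, maskT Hn.2 d)) ε (ha μ d) hb hc

end Summit.QuantumAdvantage.QuantumAdvantage.Theorems.WbwObfuscatedGluedTrees.KnowledgeOfWalk.RealIdeal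

end
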